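import Literature.Geometry.Riemannian.GradientShrinkerProofs
import Literature.Geometry.Lorentzian.RicciNormSq
import HarnessLib

/-!
# The Cheng–Ribeiro–Zhou sign-kept bound `∫(R − 2)² dV ≤ ½∫R(2 − R)(e^{c−f} − 1) dV` for `f ≤ c`
(stub `stub_crzSignKept_of_identities` of line `cgy-variance-pivot`, crux
`EntropyRung.CompactShrinkerGap`, item stmt-SmoothPoincare4-10870)

For a Riemannian metric `g` (Levi-Civita connection) on a closed `4`-manifold, a smooth `f` with
`f ≤ c`, GIVEN the pointwise trace bound (T) `R² ≤ 4|Ric|²` and the integrated defect identity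
(I) `∫(R − 2)² dV = ∫(R − 2|Ric|²)(e^{c−f} − 1) dV` (both landed separately; here they are
hypotheses), the SIGN-KEPT form of the Cheng–Ribeiro–Zhou bound (§3.2 and Remark 2) holds:
`∫_M (R − 2)² dV_g ≤ ½ ∫_M R(2 − R)(e^{c−f} − 1) dV_g`.

Proof (real/measure bookkeeping only; every integrand is continuous on a compact manifold of finite
volume): pointwise, (T) gives `2|Ric|² ≥ R²/2`, so `R − 2|Ric|² ≤ R − R²/2 = ½·R·(2 − R)`, while
`f ≤ c` gives the non-negative weight `e^{c−f} − 1 ≥ 0`; hence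
`(R − 2|Ric|²)(e^{c−f} − 1) ≤ ½(R(2 − R)(e^{c−f} − 1))`. Integrating (`integral_mono`), pulling
the constant `½` out (`integral_const_mul`), (I) finishes. Equality at the round shrinker
`S⁴(√6)`, `f ≡ 2`, `c = 2`: both sides `0`.
Everything is proved; no definition, no named fact.

References: X. Cheng, E. Ribeiro Jr, D. Zhou, arXiv:2203.14916, §3.2 and Remark 2
[ChengRibeiroZhou2022].
-/

noncomputable section

-- the registered namespace `Summit.SmoothPoincare4.SmoothPoincare4.Theorems` repeats a component
set_option linter.dupNamespace false

open Bundle Set Function Filter Module MeasureTheory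
open scoped Manifold ContDiff Topology

namespace Summit.SmoothPoincare4.SmoothPoincare4.Theorems

open Literature.Geometry Literature.Geometry.Lorentzian Literature.Geometry.Riemannian
  Literature.Geometry.Lorentzian.PseudoRiemannianMetric

/-- **STUB `stub_crzSignKept_of_identities` of line `cgy-variance-pivot` — the Cheng–Ribeiro–Zhou
sign-kept bound `∫(R − 2)² dV ≤ ½∫R(2 − R)(e^{c−f} − 1) dV` for `f ≤ c`, from the trace bound and
the defect identity as hypotheses.** On a CLOSED 4-manifold with Riemannian `g` (Levi-Civita),
smooth `f ≤ c`, GIVEN `R² ≤ 4|Ric|²` pointwise and `∫(R − 2)² = ∫(R − 2|Ric|²)(e^{c−f} − 1)`: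
pointwise `R − 2|Ric|² ≤ R − R²/2 = ½R(2 − R)` and `e^{c−f} − 1 ≥ 0`, so
`∫(R − 2)² ≤ ½∫R(2 − R)(e^{c−f} − 1)` (integrands continuous on the compact `M`:
`contMDiff_scalarCurvature`, `contMDiff_normSq_ricci'`; `riemVolume_eq`, `integral_mono`,
`integral_const_mul`). Equality at the round shrinker with `c = 2`. This keeps the sign
information `R(2 − R)` that the crude form `≤ ½∫(e^{c−f} − 1)` discards.
[cite: ChengRibeiroZhou2022, §3.2 and Rem. 2] -/
theorem stub_crzSignKept_of_identities :
    ∀ (M : Type) [TopologicalSpace M] [T2Space M] [SecondCountableTopology M]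
      [ChartedSpace (EuclideanSpace ℝ (Fin 4)) M] [IsManifold (𝓡 4) ∞ M] [CompactSpace M]
      [T3Space M] [MeasurableSpace M] [BorelSpace M]
      (g : Literature.Geometry.Lorentzian.PseudoRiemannianMetric (𝓡 4) ∞ (EuclideanSpace ℝ (Fin 4))
        (TangentSpace (𝓡 4) : M → Type _)) [g.HasLeviCivita] (f : M → ℝ) (hg : g.IsRiemannian),
      ContMDiff (𝓡 4) 𝓘(ℝ, ℝ) ∞ f →
      (∀ x : M, g.scalarCurvature x ^ 2 ≤ 4 * g.normSq x (g.ricci x)) →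
      ∀ c : ℝ, (∀ x : M, f x ≤ c) →
      ∫ x, (g.scalarCurvature x - 2) ^ 2
          ∂(Literature.Geometry.Lorentzian.riemannianMeasure (g.toContMDiffRiemannianMetric hg)) =
        ∫ x, (g.scalarCurvature x - 2 * g.normSq x (g.ricci x)) * (Real.exp (c - f x) - 1)
          ∂(Literature.Geometry.Lorentzian.riemannianMeasure (g.toContMDiffRiemannianMetric hg)) →
      ∫ x, (g.scalarCurvature x - 2) ^ 2
          ∂(Literature.Geometry.Lorentzian.riemannianMeasure (g.toContMDiffRiemannianMetric hg)) ≤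
        1 / 2 * ∫ x, g.scalarCurvature x * (2 - g.scalarCurvature x) * (Real.exp (c - f x) - 1)
          ∂(Literature.Geometry.Lorentzian.riemannianMeasure (g.toContMDiffRiemannianMetric hg)) := by
  intro M _ _ _ _ _ _ _ _ _ g _ f hg hf hT c hfc hI
  -- the Riemannian measure is `g.riemVolume`, a finite measure
  have hV : g.riemVolume = riemannianMeasure (g.toContMDiffRiemannianMetric hg) :=
    PseudoRiemannianMetric.riemVolume_eq hg
  haveI : IsFiniteMeasure g.riemVolume := ⟨g.riemVolume_univ_lt_top⟩
  rw [← hV] at hI ⊢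
  -- continuity, hence integrability, of every integrand
  have hRc : Continuous g.scalarCurvature := g.contMDiff_scalarCurvature.continuous
  have hQc : Continuous fun x ↦ g.normSq x (g.ricci x) := g.contMDiff_normSq_ricci'.continuous
  have hwc : Continuous fun x ↦ Real.exp (c - f x) - 1 :=
    (Real.continuous_exp.comp (continuous_const.sub hf.continuous)).sub continuous_const
  have iL : Integrable (fun x ↦ (g.scalarCurvature x - 2 * g.normSq x (g.ricci x)) *
      (Real.exp (c - f x) - 1)) g.riemVolume :=
    g.integrable_of_continuous ((hRc.sub (continuous_const.mul hQc)).mul hwc)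
  have iR : Integrable (fun x ↦ 1 / 2 * (g.scalarCurvature x * (2 - g.scalarCurvature x) *
      (Real.exp (c - f x) - 1))) g.riemVolume :=
    g.integrable_of_continuous
      (continuous_const.mul ((hRc.mul (continuous_const.sub hRc)).mul hwc))
  -- pointwise: `R − 2|Ric|² ≤ ½R(2 − R)` (trace bound) against the weight `e^{c−f} − 1 ≥ 0`
  have hpt : ∀ x, (g.scalarCurvature x - 2 * g.normSq x (g.ricci x)) * (Real.exp (c - f x) - 1) ≤
      1 / 2 * (g.scalarCurvature x * (2 - g.scalarCurvature x) * (Real.exp (c - f x) - 1)) :=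
    fun x ↦ by
    have h1 : g.scalarCurvature x - 2 * g.normSq x (g.ricci x) ≤
        1 / 2 * (g.scalarCurvature x * (2 - g.scalarCurvature x)) := by
      nlinarith [hT x]
    have h2 : 0 ≤ Real.exp (c - f x) - 1 := by
      linarith [Real.add_one_le_exp (c - f x), hfc x]
    calc (g.scalarCurvature x - 2 * g.normSq x (g.ricci x)) * (Real.exp (c - f x) - 1)
        ≤ 1 / 2 * (g.scalarCurvature x * (2 - g.scalarCurvature x)) * (Real.exp (c - f x) - 1) :=
          mul_le_mul_of_nonneg_right h1 h2
      _ = 1 / 2 * (g.scalarCurvature x * (2 - g.scalarCurvature x) * (Real.exp (c - f x) - 1)) := by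
          ring
  have hle := integral_mono iL iR hpt
  rw [integral_const_mul] at hle
  rw [hI]
  exact hle

end Summit.SmoothPoincare4.SmoothPoincare4.Theorems

end
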